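import Summits.ABC.IUTFork.Cor312RegimeVerbatimPrVolExact
import HarnessLib

/-!
# [IUTchIII] Cor. 3.12 — the regime dichotomy at the print-normalised sharp setting of record made EXACT, II:
# `0 ≤ −|log(Θ)|(𝟙) ≤ C₂` and the criterion `Statement ⟺ ↑(Qside − Θside) ≤ −|log(Θ)|(𝟙)`

PROOF-ONLY support piece of the abc-iut cell (Cor. 3.12 cone, D-0067; seat abc-iut-w4-d107, gen 5; part 12 of the
`Cor312NegLogThetaUpperPrVol*` / `Cor312RegimeVerbatimPrVol*` chain, sequel of part 11 `Cor312RegimeVerbatimPrVolExact`).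
TAKES NO SIDE on [IUTchIII] Cor. 3.12; theorems only, 0 `def`s, no new `Prop` fact, no instance.

Setting and notation as in part 11: abc-iut-c312-7's `Real.settingPrVolSharp`; pilot data `X` whose places of `S` lie
over a finite set `U` of ODD primes UNRAMIFIED in `F`; Θ-exponents `m_{i,p}` and `q`-exponents `m_{q,p}` over `U`;
`Θside := PN_i Σ_{p∈U} Σ_{v⃗} Pr(v⃗)·(−min_a m_{i,p}(v⃗ a)·log p)`, `Qside := PN_i Σ_{p∈U} Σ_{v⃗} Pr(v⃗)·(−m_{q,p}(v⃗(last))·log p)`;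
`𝟙` = the trivial (unit) ideles at the same context binders; part 11 proved
`−|log(Θ)|(t_q, t) = −|log(Θ)|(𝟙) + Θside` (`negLogTheta_settingPrVolSharp_eq_trivial_add_exact`).

* §1 `negLogTheta_settingPrVolSharp_trivial_nonneg` / `…_trivial_le_of_radii` — `0 ≤ −|log(Θ)|(𝟙) ≤ C₂`, with `C₂` part
  8's radii constant `PN_i Σ_{p∈Bad} max(log(p²R_{p,i}/r_{p,i}), 0)` of the exceptional primes `2`, `p | disc(F)` (parts
  7/8's bounds at the zero exponents);
* §2 **`statement_settingPrVolSharp_iff_exact`** — `Statement(t_q, t) ⟺ ↑(Qside − Θside) ≤ −|log(Θ)|(𝟙)` (with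
  abc-iut-c312-7's exact `q`-side, part 7 `negLogQ_settingPrVolSharp_eq_exact`);
* §3 **`settingPrVolSharp_regime_exact`** — the packaged successor of part 8's `settingPrVolSharp_regime_dichotomy`:
  `∃ C₂ ≥ 0` from `(X, logv)` before every binder, and for every context and every such ideles
  `0 ≤ −|log(Θ)|(𝟙) ≤ C₂ ∧ −|log(Θ)|(t_q,t) = −|log(Θ)|(𝟙) + Θside ∧ (Statement ⟺ ↑(Qside − Θside) ≤ −|log(Θ)|(𝟙))`.
So at genuine sharp data over odd unramified bad primes the typed [IUTchIII] Cor. 3.12 is EQUIVALENT to one explicit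
inequality between the `q`-exponent mass and the slot-symmetrised Θ-exponent mass, shifted by the Θ-volume of the
trivial configuration (the hull inflation of the unit boxes at `2` and at `p | disc(F)`; one datum-independent number in
`[0, C₂]`): part 8's halves `Qside ≤ Θside ⟹ Statement` / `Θside + C₂ < Qside ⟹ ¬Statement` are the cases
`−|log(Θ)|(𝟙) ≥ 0` / `≤ C₂`, and the band between them is decided by that single number — in BOTH directions by
bookkeeping ((Ind1)-symmetrisation versus `q`-depth), independently of the disputed (xi-e)/(xi-f) inference.
HONEST SCOPE as in parts 7–11: (Ind2) as typed at the real setting (`Real.ismDH`); sharp (Ind3) reading; trivial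
archimedean container; free ideles (realising ideles of an initial Θ-datum exist iff `2l ∣ ord_v(q_v)`, plan C-R16); the
positive instances are inflation-dominated and say nothing about print's intended content; nothing here asserts or
denies [IUTchIII] Cor. 3.12 for initial Θ-data. typed ≠ proved; instantiated ≠ endorsed.
[claim: Mochizuki2012, status: disputed] [cite: DupuyHilado2025, §3.6, §3.9, §4.7, §4.9, §4.10]
[cite: ScholzeStix2018, §2.2 pp. 9–10]
-/

noncomputable section

open Set Function NumberField IsDedekindDomain
open scoped Pointwise

namespace Summit.ABC

namespace IUTFork

namespace Thm311

namespace Real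

open Cor312 Cor312.Setting Cor312Vol Literature.IUT.LogThetaLattice Literature.IUT.LogVolume

variable {F : Type} [Field F] [NumberField F] (X : PilotData F) {logv : PadicLogs F} (hlog : LogvAnalytic logv)

section Exact

variable (M : Type) [Field M] [NumberField M]
  (archPk : ∀ (j : (thetaIndex X).Label) (vQ : (thetaIndex X).VQ), Set ((logShellsDH X logv).Packet j vQ))
  (archSub : ∀ (j : (thetaIndex X).Label) (v : (thetaIndex X).V),
    Set ((logShellsDH X logv).Packet j ((thetaIndex X).over v)))
  (Ψ : ℤ → ∀ v : (thetaIndex X).V, v ∈ (thetaIndex X).Vbad → Set ((logShellsDH X logv).StarPacket v))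
  (act : ℤ → ∀ v : (thetaIndex X).V, v ∈ (thetaIndex X).Vbad →
    (logShellsDH X logv).StarPacket v → Module.End ℚ ((logShellsDH X logv).StarPacket v))
  (Mmod : ℤ → ∀ j : (thetaIndex X).LabelStar, Set ((logShellsDH X logv).GlobalPacket j.1))
  (region : ℤ → ∀ j : (thetaIndex X).LabelStar, FinDivisor M → ∀ vQ : (thetaIndex X).VQ,
    Set ((logShellsDH X logv).Packet j.1 vQ))
  (n : ℤ) {HT : Type} {LogLink : HT → HT → Type} {IsFull : ∀ {s t : HT}, LogLink s t → Prop}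
  (lat : LGPGaussianLogThetaLattice LogLink IsFull)
  {Frd : Type} {IsoF : Frd → Frd → Type} {Ob : Frd → Type} {realify : Frd → Frd} {Strip : Type}
  {IsoS : Strip → Strip → Type} {Mv : ∀ v : (thetaIndex X).V, v ∈ (thetaIndex X).Vbad → Type}
  [∀ v h, Monoid (Mv v h)]
  (sig : GlobalLGPFrobenioidSignature (thetaIndex X).lstar (thetaIndex X).V (· ∈ (thetaIndex X).Vbad)
    Frd IsoF Ob realify Strip IsoS Mv)
  (split : SplittingMonoids Mv) {ObΔ : Type} {N : ∀ v : (thetaIndex X).V, v ∈ (thetaIndex X).Vbad → Type}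
  [∀ v h, Monoid (N v h)] (qData : QPilotData ObΔ N)
  (t : ∀ (pp : Nat.Primes) (_ : Fin X.lstar) (x : (thetaIndex X).Fibre (.inr pp)),
    haveI : Fact (pp : ℕ).Prime := ⟨pp.2⟩; kOf X pp.1 x)
  (tq : ∀ (pp : Nat.Primes) (x : (thetaIndex X).Fibre (.inr pp)), haveI : Fact (pp : ℕ).Prime := ⟨pp.2⟩; kOf X pp.1 x)

/-! ## §1. `0 ≤ −|log(Θ)|(𝟙) ≤ C₂` -/

/-- **`0 ≤ −|log(Θ)|(𝟙)`** for pilot data whose places of `S` lie over odd unramified primes (box ≤ hull at every packet,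
and every Θ-box of `𝟙` is a unit box: part 7's lower bound at the zero exponents). [cite: DupuyHilado2025, §3.9] -/
theorem negLogTheta_settingPrVolSharp_trivial_nonneg (U : Finset Nat.Primes)
    (hU : ∀ (pp : Nat.Primes) (x : (thetaIndex X).Fibre (.inr pp)),
      haveI : Fact (pp : ℕ).Prime := ⟨pp.2⟩; placeOf X pp.1 x ∈ X.S → pp ∈ U)
    (hU2 : ∀ pp ∈ U, 2 < (pp : ℕ)) (hUd : ∀ pp ∈ U, ¬ ((pp : ℕ) : ℤ) ∣ NumberField.discr F) :
    (0 : WithTop ℝ) ≤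
      (settingPrVolSharp X hlog M archPk archSub Ψ act Mmod region n lat sig split qData (fun _ _ => 1) (fun _ _ _ => 1)
        (fun _ _ => one_ne_zero) (fun _ _ _ => norm_one)).negLogTheta := by
  have h := negLogTheta_settingPrVolSharp_ge_exact X hlog M archPk archSub Ψ act Mmod region n lat sig split qData
    (fun _ _ _ => 1) (fun _ _ => 1) (fun _ _ _ => one_ne_zero) (fun _ _ _ _ => norm_one) (fun _ _ => one_ne_zero)
    (fun _ _ _ => norm_one) U hU hU2 hUd (fun _ _ _ => 0) (fun pp _ i x => by simp)
  have h0 : processionNormalized (fun i : Fin (thetaIndex X).lstar => ∑ pp ∈ U,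
      (haveI : Fact (pp : ℕ).Prime := ⟨pp.2⟩;
        ∑ e : (presAt X hlog pp).toLocalPieces.E (Setting.labelSucc i),
          weightPr X pp.1 (Setting.labelSucc i) e *
            (-(Finset.univ.inf' Finset.univ_nonempty (fun _ : (thetaIndex X).Caps (Setting.labelSucc i) => (0 : ℤ)) *
              Real.log (pp : ℕ))))) = 0 := by
    have : (fun i : Fin (thetaIndex X).lstar => ∑ pp ∈ U,
      (haveI : Fact (pp : ℕ).Prime := ⟨pp.2⟩;
        ∑ e : (presAt X hlog pp).toLocalPieces.E (Setting.labelSucc i),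
          weightPr X pp.1 (Setting.labelSucc i) e *
            (-(Finset.univ.inf' Finset.univ_nonempty (fun _ : (thetaIndex X).Caps (Setting.labelSucc i) => (0 : ℤ)) *
              Real.log (pp : ℕ))))) = fun _ => 0 :=
      funext fun i => Finset.sum_eq_zero fun pp _ => sum_weightPr_mul_inf'_zero_eq_zero X hlog i pp
    rw [this]
    unfold processionNormalized
    rw [Finset.sum_const_zero, zero_div]
  rw [h0] at h
  exact_mod_cast h

/-- **`−|log(Θ)|(𝟙) ≤ C₂`**, radii form: the Θ-volume of the trivial configuration is at most part 8's constant
`PN_i Σ_{p∈Bad} max(log(p²R_{p,i}/r_{p,i}), 0)` of the exceptional primes (part 8's upper bound at the zero exponents).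
[cite: DupuyHilado2025, §4.9, §4.10] -/
theorem negLogTheta_settingPrVolSharp_trivial_le_of_radii (U : Finset Nat.Primes)
    (hU : ∀ (pp : Nat.Primes) (x : (thetaIndex X).Fibre (.inr pp)),
      haveI : Fact (pp : ℕ).Prime := ⟨pp.2⟩; placeOf X pp.1 x ∈ X.S → pp ∈ U)
    (hU2 : ∀ pp ∈ U, 2 < (pp : ℕ)) (hUd : ∀ pp ∈ U, ¬ ((pp : ℕ) : ℤ) ∣ NumberField.discr F)
    (Bad : Finset Nat.Primes) (hBad2 : ∀ pp : Nat.Primes, (pp : ℕ) ≤ 2 → pp ∈ Bad)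
    (hBadD : ∀ pp : Nat.Primes, ((pp : ℕ) : ℤ) ∣ NumberField.discr F → pp ∈ Bad)
    (r R : Nat.Primes → Fin (thetaIndex X).lstar → ℝ) (hr0 : ∀ pp i, 0 < r pp i) (hR0 : ∀ pp i, 0 < R pp i)
    (hball : ∀ (pp : Nat.Primes) (i : Fin (thetaIndex X).lstar), haveI : Fact (pp : ℕ).Prime := ⟨pp.2⟩
      ∀ z : (∀ s : (presAt X hlog pp).factorIdx (labelSucc i), (presAt X hlog pp).factorField (labelSucc i) s),
        (∀ s, ‖z s‖ < r pp i) → z ∈ (presAt X hlog pp).latticeF (labelSucc i) 1)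
    (hbdd : ∀ (pp : Nat.Primes) (i : Fin (thetaIndex X).lstar), haveI : Fact (pp : ℕ).Prime := ⟨pp.2⟩
      ∀ z ∈ (presAt X hlog pp).latticeF (labelSucc i) 1, ∀ s, ‖z s‖ ≤ R pp i) :
    (settingPrVolSharp X hlog M archPk archSub Ψ act Mmod region n lat sig split qData (fun _ _ => 1) (fun _ _ _ => 1)
        (fun _ _ => one_ne_zero) (fun _ _ _ => norm_one)).negLogTheta ≤
      ((processionNormalized (fun i : Fin (thetaIndex X).lstar =>
          ∑ pp ∈ Bad, max (Real.log (((pp : ℕ) : ℝ) ^ 2 * R pp i / r pp i)) 0) : ℝ) : WithTop ℝ) := by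
  have h := negLogTheta_settingPrVolSharp_le_exact_of_radii X hlog M archPk archSub Ψ act Mmod region n lat sig split
    qData (fun _ _ _ => 1) (fun _ _ => 1) (fun _ _ _ => one_ne_zero) (fun _ _ _ _ => norm_one) (fun _ _ => one_ne_zero)
    (fun _ _ _ => norm_one) U hU hU2 hUd (fun _ _ _ => 0) (fun pp _ i x => by simp) Bad hBad2 hBadD r R hr0 hR0 hball
    hbdd
  have h0 : (fun i : Fin (thetaIndex X).lstar => ∑ pp ∈ U,
      (haveI : Fact (pp : ℕ).Prime := ⟨pp.2⟩;
        ∑ e : (presAt X hlog pp).toLocalPieces.E (Setting.labelSucc i),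
          weightPr X pp.1 (Setting.labelSucc i) e *
            (-(Finset.univ.inf' Finset.univ_nonempty (fun _ : (thetaIndex X).Caps (Setting.labelSucc i) => (0 : ℤ)) *
              Real.log (pp : ℕ))))) = fun _ => 0 :=
    funext fun i => Finset.sum_eq_zero fun pp _ => sum_weightPr_mul_inf'_zero_eq_zero X hlog i pp
  rw [h0] at h
  have h00 : processionNormalized (fun _ : Fin (thetaIndex X).lstar => (0 : ℝ)) = 0 := by
    unfold processionNormalized; rw [Finset.sum_const_zero, zero_div]
  rw [h00, zero_add] at h
  exact h

/-! ## §2. The exact criterion: `Statement ⟺ Qside − Θside ≤ −|log(Θ)|(𝟙)` -/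

/-- **THE EXACT REGIME CRITERION at the verbatim sharp setting of record.** For pilot data whose places of `S` lie
over a finite set `U` of ODD primes UNRAMIFIED in `F`, and pilot ideles (non-zero, units off `S`) with Θ-exponents
`m_{i,p}` and `q`-exponents `m_{q,p}` over `U`, the typed Statement of [IUTchIII] Cor. 3.12
(`−|log(Θ)| ∈ ℝ ∧ −|log(q)| ≤ −|log(Θ)|`) at `Real.settingPrVolSharp` holds IF AND ONLY IF
`Qside − Θside ≤ −|log(Θ)|(𝟙)`, i.e.
`PN_i Σ_{p∈U} Σ_{v⃗} Pr(v⃗)·(−m_{q,p}(v⃗(last))·log p) − PN_i Σ_{p∈U} Σ_{v⃗} Pr(v⃗)·(−min_a m_{i,p}(v⃗ a)·log p)` is at most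
the Θ-volume of the TRIVIAL configuration (the hull inflation of the unit boxes at `2` and at `p | disc(F)`, a
datum-independent number in `[0, C₂]`). No undecided band is left; both directions are bookkeeping ((Ind1)-symmetrisation
versus `q`-depth), NOT the disputed (xi-e)/(xi-f) inference; no side taken. [claim: Mochizuki2012, status: disputed]
[cite: DupuyHilado2025, §3.6, §3.9, §4.7] -/
theorem statement_settingPrVolSharp_iff_exact (ht0 : ∀ pp i x, t pp i x ≠ 0)
    (ht1 : ∀ (pp : Nat.Primes) (i : Fin X.lstar) (x : (thetaIndex X).Fibre (.inr pp)),
      haveI : Fact (pp : ℕ).Prime := ⟨pp.2⟩; placeOf X pp.1 x ∉ X.S → ‖t pp i x‖ = 1)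
    (htq0 : ∀ pp x, tq pp x ≠ 0)
    (htq1 : ∀ (pp : Nat.Primes) (x : (thetaIndex X).Fibre (.inr pp)),
      haveI : Fact (pp : ℕ).Prime := ⟨pp.2⟩; placeOf X pp.1 x ∉ X.S → ‖tq pp x‖ = 1)
    (U : Finset Nat.Primes)
    (hU : ∀ (pp : Nat.Primes) (x : (thetaIndex X).Fibre (.inr pp)),
      haveI : Fact (pp : ℕ).Prime := ⟨pp.2⟩; placeOf X pp.1 x ∈ X.S → pp ∈ U)
    (hU2 : ∀ pp ∈ U, 2 < (pp : ℕ)) (hUd : ∀ pp ∈ U, ¬ ((pp : ℕ) : ℤ) ∣ NumberField.discr F)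
    (m : ∀ pp : Nat.Primes, Fin (thetaIndex X).lstar → (thetaIndex X).Fibre (.inr pp) → ℤ)
    (hm : ∀ (pp : Nat.Primes), pp ∈ U → ∀ (i : Fin (thetaIndex X).lstar) (x : (thetaIndex X).Fibre (.inr pp)),
      haveI : Fact (pp : ℕ).Prime := ⟨pp.2⟩; ‖t pp i x‖ = ‖((pp : ℕ) : ℚ_[pp]) ^ m pp i x‖)
    (mq : ∀ pp : Nat.Primes, (thetaIndex X).Fibre (.inr pp) → ℤ)
    (hmq : ∀ (pp : Nat.Primes), pp ∈ U → ∀ (x : (thetaIndex X).Fibre (.inr pp)),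
      haveI : Fact (pp : ℕ).Prime := ⟨pp.2⟩; ‖tq pp x‖ = ‖((pp : ℕ) : ℚ_[pp]) ^ mq pp x‖) :
    (settingPrVolSharp X hlog M archPk archSub Ψ act Mmod region n lat sig split qData tq t htq0 htq1).Statement ↔
      ((processionNormalized (fun i : Fin (thetaIndex X).lstar => ∑ pp ∈ U,
            (haveI : Fact (pp : ℕ).Prime := ⟨pp.2⟩;
              ∑ e : (presAt X hlog pp).toLocalPieces.E (Setting.labelSucc i),
                weightPr X pp.1 (Setting.labelSucc i) e * (-(mq pp (e (Fin.last _))) * Real.log (pp : ℕ)))) -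
          processionNormalized (fun i : Fin (thetaIndex X).lstar => ∑ pp ∈ U,
            (haveI : Fact (pp : ℕ).Prime := ⟨pp.2⟩;
              ∑ e : (presAt X hlog pp).toLocalPieces.E (Setting.labelSucc i),
                weightPr X pp.1 (Setting.labelSucc i) e *
                  (-(Finset.univ.inf' Finset.univ_nonempty (fun a => m pp i (e a)) * Real.log (pp : ℕ))))) : ℝ) :
          WithTop ℝ) ≤
        (settingPrVolSharp X hlog M archPk archSub Ψ act Mmod region n lat sig split qData (fun _ _ => 1)
          (fun _ _ _ => 1) (fun _ _ => one_ne_zero) (fun _ _ _ => norm_one)).negLogTheta := by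
  have hdec := negLogTheta_settingPrVolSharp_eq_trivial_add_exact X hlog M archPk archSub Ψ act Mmod region n lat sig split
    qData t tq ht0 ht1 htq0 htq1 U hU hU2 hUd m hm
  have hq := negLogQ_settingPrVolSharp_eq_exact X hlog M archPk archSub Ψ act Mmod region n lat sig split qData t tq htq0
    htq1 U hU mq hmq
  obtain ⟨K₀, hK₀⟩ := WithTop.ne_top_iff_exists.mp (negLogTheta_settingPrVolSharp_trivial_ne_top X hlog M archPk archSub
    Ψ act Mmod region n lat sig split qData)
  unfold Setting.Statement
  rw [hdec, hq, ← hK₀, ← WithTop.coe_add, WithTop.coe_le_coe, WithTop.coe_le_coe]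
  constructor
  · rintro ⟨-, h⟩
    linarith
  · intro h
    exact ⟨WithTop.coe_ne_top, by linarith⟩

/-! ## §3. The packaged form -/

/-- **THE EXACT REGIME CRITERION, packaged** (successor of part 8's `settingPrVolSharp_regime_dichotomy`): `∃ C₂ ≥ 0`
chosen from `(X, logv)` BEFORE every context and idele binder such that, for every context, with `𝟙` the trivial
ideles at that context and for every pilot ideles whose bad places lie over a finite set `U` of odd primes unramified in
`F` with Θ-exponents `m` and `q`-exponents `m_q` over `U`:
`0 ≤ −|log(Θ)|(𝟙) ≤ C₂`, `−|log(Θ)|(t_q, t) = −|log(Θ)|(𝟙) + Θside`, and `Statement(t_q, t) ⟺ ↑(Qside − Θside) ≤ −|log(Θ)|(𝟙)`.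
Part 8's halves are its corollaries (`Qside ≤ Θside ⟹ Statement` since `−|log(Θ)|(𝟙) ≥ 0`;
`Θside + C₂ < Qside ⟹ ¬Statement` since `−|log(Θ)|(𝟙) ≤ C₂`); the band between them is decided by the single number
`−|log(Θ)|(𝟙)`. No side taken on [IUTchIII] Cor. 3.12. [claim: Mochizuki2012, status: disputed]
[cite: DupuyHilado2025, §3.6, §3.9, §4.7, §4.9, §4.10] -/
theorem settingPrVolSharp_regime_exact :
    ∃ C₂ : ℝ, 0 ≤ C₂ ∧
      ∀ (M : Type) [Field M] [NumberField M]
        (archPk : ∀ (j : (thetaIndex X).Label) (vQ : (thetaIndex X).VQ), Set ((logShellsDH X logv).Packet j vQ))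
        (archSub : ∀ (j : (thetaIndex X).Label) (v : (thetaIndex X).V),
          Set ((logShellsDH X logv).Packet j ((thetaIndex X).over v)))
        (Ψ : ℤ → ∀ v : (thetaIndex X).V, v ∈ (thetaIndex X).Vbad → Set ((logShellsDH X logv).StarPacket v))
        (act : ℤ → ∀ v : (thetaIndex X).V, v ∈ (thetaIndex X).Vbad →
          (logShellsDH X logv).StarPacket v → Module.End ℚ ((logShellsDH X logv).StarPacket v))
        (Mmod : ℤ → ∀ j : (thetaIndex X).LabelStar, Set ((logShellsDH X logv).GlobalPacket j.1))
        (region : ℤ → ∀ j : (thetaIndex X).LabelStar, FinDivisor M → ∀ vQ : (thetaIndex X).VQ,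
          Set ((logShellsDH X logv).Packet j.1 vQ))
        (n : ℤ) (HT : Type) (LogLink : HT → HT → Type) (IsFull : ∀ {s t : HT}, LogLink s t → Prop)
        (lat : LGPGaussianLogThetaLattice LogLink IsFull)
        (Frd : Type) (IsoF : Frd → Frd → Type) (Ob : Frd → Type) (realify : Frd → Frd) (Strip : Type)
        (IsoS : Strip → Strip → Type) (Mv : ∀ v : (thetaIndex X).V, v ∈ (thetaIndex X).Vbad → Type)
        (_ : ∀ v h, Monoid (Mv v h))
        (sig : GlobalLGPFrobenioidSignature (thetaIndex X).lstar (thetaIndex X).V (· ∈ (thetaIndex X).Vbad)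
          Frd IsoF Ob realify Strip IsoS Mv)
        (split : SplittingMonoids Mv) (ObΔ : Type) (N : ∀ v : (thetaIndex X).V, v ∈ (thetaIndex X).Vbad → Type)
        (_ : ∀ v h, Monoid (N v h)) (qData : QPilotData ObΔ N)
        (tq : ∀ (pp : Nat.Primes) (x : (thetaIndex X).Fibre (.inr pp)),
          haveI : Fact (pp : ℕ).Prime := ⟨pp.2⟩; kOf X pp.1 x)
        (t : ∀ (pp : Nat.Primes) (_ : Fin X.lstar) (x : (thetaIndex X).Fibre (.inr pp)),
          haveI : Fact (pp : ℕ).Prime := ⟨pp.2⟩; kOf X pp.1 x)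
        (ht0 : ∀ pp i x, t pp i x ≠ 0)
        (_ : ∀ (pp : Nat.Primes) (i : Fin X.lstar) (x : (thetaIndex X).Fibre (.inr pp)),
          haveI : Fact (pp : ℕ).Prime := ⟨pp.2⟩; placeOf X pp.1 x ∉ X.S → ‖t pp i x‖ = 1)
        (htq0 : ∀ pp x, tq pp x ≠ 0)
        (htq1 : ∀ (pp : Nat.Primes) (x : (thetaIndex X).Fibre (.inr pp)),
          haveI : Fact (pp : ℕ).Prime := ⟨pp.2⟩; placeOf X pp.1 x ∉ X.S → ‖tq pp x‖ = 1)
        (U : Finset Nat.Primes),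
        (∀ (pp : Nat.Primes) (x : (thetaIndex X).Fibre (.inr pp)),
          haveI : Fact (pp : ℕ).Prime := ⟨pp.2⟩; placeOf X pp.1 x ∈ X.S → pp ∈ U) →
        (∀ pp ∈ U, 2 < (pp : ℕ)) → (∀ pp ∈ U, ¬ ((pp : ℕ) : ℤ) ∣ NumberField.discr F) →
        ∀ (m : ∀ pp : Nat.Primes, Fin (thetaIndex X).lstar → (thetaIndex X).Fibre (.inr pp) → ℤ),
        (∀ (pp : Nat.Primes), pp ∈ U → ∀ (i : Fin (thetaIndex X).lstar) (x : (thetaIndex X).Fibre (.inr pp)),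
          haveI : Fact (pp : ℕ).Prime := ⟨pp.2⟩; ‖t pp i x‖ = ‖((pp : ℕ) : ℚ_[pp]) ^ m pp i x‖) →
        ∀ (mq : ∀ pp : Nat.Primes, (thetaIndex X).Fibre (.inr pp) → ℤ),
        (∀ (pp : Nat.Primes), pp ∈ U → ∀ (x : (thetaIndex X).Fibre (.inr pp)),
          haveI : Fact (pp : ℕ).Prime := ⟨pp.2⟩; ‖tq pp x‖ = ‖((pp : ℕ) : ℚ_[pp]) ^ mq pp x‖) →
        (0 : WithTop ℝ) ≤ (settingPrVolSharp X hlog M archPk archSub Ψ act Mmod region n lat sig split qData (fun _ _ => 1)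
            (fun _ _ _ => 1) (fun _ _ => one_ne_zero) (fun _ _ _ => norm_one)).negLogTheta ∧
        (settingPrVolSharp X hlog M archPk archSub Ψ act Mmod region n lat sig split qData (fun _ _ => 1)
            (fun _ _ _ => 1) (fun _ _ => one_ne_zero) (fun _ _ _ => norm_one)).negLogTheta ≤ ((C₂ : ℝ) : WithTop ℝ) ∧
        (settingPrVolSharp X hlog M archPk archSub Ψ act Mmod region n lat sig split qData tq t htq0 htq1).negLogTheta =
          (settingPrVolSharp X hlog M archPk archSub Ψ act Mmod region n lat sig split qData (fun _ _ => 1)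
              (fun _ _ _ => 1) (fun _ _ => one_ne_zero) (fun _ _ _ => norm_one)).negLogTheta +
            ((processionNormalized (fun i : Fin (thetaIndex X).lstar => ∑ pp ∈ U,
              (haveI : Fact (pp : ℕ).Prime := ⟨pp.2⟩;
                ∑ e : (presAt X hlog pp).toLocalPieces.E (Setting.labelSucc i),
                  weightPr X pp.1 (Setting.labelSucc i) e *
                    (-(Finset.univ.inf' Finset.univ_nonempty (fun a => m pp i (e a)) * Real.log (pp : ℕ))))) : ℝ) :
              WithTop ℝ) ∧
        ((settingPrVolSharp X hlog M archPk archSub Ψ act Mmod region n lat sig split qData tq t htq0 htq1).Statement ↔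
          ((processionNormalized (fun i : Fin (thetaIndex X).lstar => ∑ pp ∈ U,
                (haveI : Fact (pp : ℕ).Prime := ⟨pp.2⟩;
                  ∑ e : (presAt X hlog pp).toLocalPieces.E (Setting.labelSucc i),
                    weightPr X pp.1 (Setting.labelSucc i) e * (-(mq pp (e (Fin.last _))) * Real.log (pp : ℕ)))) -
              processionNormalized (fun i : Fin (thetaIndex X).lstar => ∑ pp ∈ U,
                (haveI : Fact (pp : ℕ).Prime := ⟨pp.2⟩;
                  ∑ e : (presAt X hlog pp).toLocalPieces.E (Setting.labelSucc i),
                    weightPr X pp.1 (Setting.labelSucc i) e *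
                      (-(Finset.univ.inf' Finset.univ_nonempty (fun a => m pp i (e a)) * Real.log (pp : ℕ))))) : ℝ) :
              WithTop ℝ) ≤
            (settingPrVolSharp X hlog M archPk archSub Ψ act Mmod region n lat sig split qData (fun _ _ => 1)
              (fun _ _ _ => 1) (fun _ _ => one_ne_zero) (fun _ _ _ => norm_one)).negLogTheta) := by
  obtain ⟨Bad, r, R, hBad2, hBadD, -, hr0, hR0, hball, hbdd⟩ := exists_bad_and_radii X hlog
  refine ⟨processionNormalized (fun i : Fin (thetaIndex X).lstar =>
    ∑ pp ∈ Bad, max (Real.log (((pp : ℕ) : ℝ) ^ 2 * R pp i / r pp i)) 0), ?_, ?_⟩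
  · unfold processionNormalized
    exact div_nonneg (Finset.sum_nonneg fun i _ => Finset.sum_nonneg fun pp _ => le_max_right _ _) (Nat.cast_nonneg _)
  intro M _ _ archPk archSub Ψ act Mmod region n HT LogLink IsFull lat Frd IsoF Ob realify Strip IsoS Mv _ sig split
    ObΔ N _ qData tq t ht0 ht1 htq0 htq1 U hU hU2 hUd m hm mq hmq
  exact ⟨negLogTheta_settingPrVolSharp_trivial_nonneg X hlog M archPk archSub Ψ act Mmod region n lat sig split qData U hU
      hU2 hUd,
    negLogTheta_settingPrVolSharp_trivial_le_of_radii X hlog M archPk archSub Ψ act Mmod region n lat sig split qData U hU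
      hU2 hUd Bad hBad2 hBadD r R hr0 hR0 hball hbdd,
    negLogTheta_settingPrVolSharp_eq_trivial_add_exact X hlog M archPk archSub Ψ act Mmod region n lat sig split qData t tq
      ht0 ht1 htq0 htq1 U hU hU2 hUd m hm,
    statement_settingPrVolSharp_iff_exact X hlog M archPk archSub Ψ act Mmod region n lat sig split qData t tq ht0 ht1
      htq0 htq1 U hU hU2 hUd m hm mq hmq⟩

end Exact

end Real

end Thm311

end IUTFork

end Summit.ABC

end
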